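import Literature.AlgebraicGeometry.Frobenioids.DivisorialDescriptions
import Literature.AlgebraicGeometry.Frobenioids.DivisorialDescriptionsSections
import Literature.AlgebraicGeometry.Frobenioids.IsotropicFrobeniusTrivial
import HarnessLib

/-!
# Frobenioids I, Theorem 5.1 (iv): PROOFS (abc-iut cell, layer L1, node `FrdI:Thm5.1(iv)`, pool D-η-4)

Mochizuki, *The geometry of Frobenioids I: the general theory*, Kyushu J. Math. **62** (2008)
293–400, §5, Theorem 5.1 (iv), kurims text p. 97 (statement) and pp. 99 l. 47 – 100 l. 1 (proof)
[cite: MochizukiFrdI2008, Thm. 5.1 (iv) p.97]. PROOF-ONLY companion of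
`DivisorialDescriptionsSections.lean` (statements, seat abc-iut-L1-t5); nothing is (re)defined here.

> "Finally, we consider assertion (iv). First, we observe that since `C` is of unit-trivial type, it
> follows immediately [cf., e.g., Proposition 3.3, (iii), (iv)] that given any two objects
> `A, B ∈ Ob(C)`, a pull-back morphism `A → B` (respectively, base-identity endomorphism of Frobenius
> type of `A`) is uniquely determined by its projection to `D` (respectively, by its Frobenius
> degree). Moreover, by assertion (iii), it follows immediately that if `A, B ∈ Ob(C^Fr-tr)`, then any
> morphism `Base(A) → Base(B)` [in `D`] lifts to a pull-back morphism of `C^Fr-tr`. Thus, we conclude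
> that the natural projection functor `(C^Fr-tr)^pl-bk → D` is an equivalence of categories, hence
> that any skeletal subcategory `P ⊆ (C^Fr-tr)^pl-bk` determines a base-section of `C`, and that any
> base-section of `C` admits an associated Frobenius-section."

What is proved, for a Frobenioid `F : C → F_Φ` of isotropic and unit-trivial type:
* the two uniqueness statements of the first sentence (`IsPullbackMorphism.eq_of_base_eq`,
  `eq_of_isFrobeniusType_of_isBaseIdentity`) and their consequence that base-identity Frobenius
  endomorphisms commute with pull-back morphisms (`frobenius_comm_of_isPullbackMorphism`);
* `thm51iv_frobeniusSection : Thm51iv_frobeniusSection F` — UNCONDITIONALLY: every base-section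
  admits a Frobenius-section (the Frobenius endomorphisms of the objects of `P` assemble to a
  homomorphism `N_{≥1} → End(P ↪ C)` by the commutation just mentioned);
* `thm51iv_baseSection_of_thm51iii : Thm51iii_iso_of_baseIso F → Thm51iii_frobeniusTrivial_isAutAmple F
  → Thm51iv_baseSection F` and `thm51iv_preModel_of_thm51iii : … → Thm51iv_preModel F` — MODULO the two
  "In particular" clauses of Theorem 5.1 (iii) (named statements of `DivisorialDescriptions.lean`,
  exactly the use "by assertion (iii)" of the printed proof; they are derived from Theorem 5.1 (i) by
  seat abc-iut-found and Theorem 5.1 (i) is pool item D-η-1): the skeletal subcategory is lifted to a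
  base-section through the equivalence `(C^Fr-tr)^pl-bk → D` (full by (iii) and Def. 1.3 (i)(c),
  faithful by the first uniqueness statement, essentially surjective by Def. 1.3 (i)(a)), and a
  base-Frobenius pair is produced from a skeleton of `(C^Fr-tr)^pl-bk` chosen by representatives of
  isomorphism classes.
The fourth named statement `Thm51iv_modelType` of the statement file quantifies over an ARBITRARY
model-type predicate (its docstring: TODO-merge abc-iut-L1-t3) and is not a target here.
No statement of the paper is strengthened; no side is taken on [IUTchIII] Cor. 3.12.
-/

namespace Literature.AlgebraicGeometry.Frobenioids

namespace PreFrobenioid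

open CategoryTheory Opposite

universe w v v' u u'

variable {D : Type u} [Category.{v} D] {Φ : Dᵒᵖ ⥤ CommMonCat.{w}}
  {C : Type u'} [Category.{v'} C] (F : C ⥤ ElemFrobenioid Φ)

/-! ### The two uniqueness statements (p. 99 ll. 47–52) -/

/-- **Thm. 5.1 (iv), proof, first observation** (FrdI p. 99): in a Frobenioid of unit-trivial type
"a pull-back morphism `A → B` is uniquely determined by its projection to `D`": two pull-back
morphisms with the same base coincide (lift each along the other: the lifts are mutually inverse
base-identity linear automorphisms, i.e. units, hence trivial).
[cite: MochizukiFrdI2008, Thm. 5.1 (iv) p.99] -/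
theorem IsPullbackMorphism.eq_of_base_eq (hF : IsFrobenioid F) (hut : IsOfUnitTrivialType F)
    {A B : C} {f g : A ⟶ B} (hf : IsPullbackMorphism F f) (hg : IsPullbackMorphism F g)
    (h : Base F f = Base F g) : f = g := by
  -- lift `f` along `g` and `g` along `f`
  obtain ⟨γ, hγ⟩ := (hg A).2 ⟨(f, 𝟙 _), by rw [Category.id_comp]; exact h⟩
  have hγ1 : γ ≫ g = f := congrArg (fun p : PullbackHomData F g A => p.1.1) hγ
  have hγ2 : Base F γ = 𝟙 _ := congrArg (fun p : PullbackHomData F g A => p.1.2) hγ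
  obtain ⟨γ', hγ'⟩ := (hf A).2 ⟨(g, 𝟙 _), by rw [Category.id_comp]; exact h.symm⟩
  have hγ'1 : γ' ≫ f = g := congrArg (fun p : PullbackHomData F f A => p.1.1) hγ'
  have hγ'2 : Base F γ' = 𝟙 _ := congrArg (fun p : PullbackHomData F f A => p.1.2) hγ'
  -- the two lifts are mutually inverse (injectivity of the pull-back maps at `A`)
  have h1 : γ ≫ γ' = 𝟙 A := by
    apply (hf A).1
    apply Subtype.ext
    apply Prod.ext
    · show (γ ≫ γ') ≫ f = 𝟙 A ≫ f
      rw [Category.assoc, hγ'1, hγ1, Category.id_comp]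
    · show Base F (γ ≫ γ') = Base F (𝟙 A)
      rw [base_comp, hγ2, hγ'2, Category.id_comp, base_id]
  have h2 : γ' ≫ γ = 𝟙 A := by
    apply (hg A).1
    apply Subtype.ext
    apply Prod.ext
    · show (γ' ≫ γ) ≫ g = 𝟙 A ≫ g
      rw [Category.assoc, hγ1, hγ'1, Category.id_comp]
    · show Base F (γ' ≫ γ) = Base F (𝟙 A)
      rw [base_comp, hγ2, hγ'2, Category.id_comp, base_id]
  -- `γ` is linear (pull-back morphisms are linear, Def. 1.3 (iv)(b))
  have hfl : degFr F f = 1 := (hF.iv_b f hf).2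
  have hgl : degFr F g = 1 := (hF.iv_b g hg).2
  have hγl : IsLinear F γ := by
    show degFr F γ = 1
    have hd := congrArg (degFr F) hγ1
    rw [degFr_comp, hgl, mul_one, hfl] at hd
    exact hd
  -- hence a unit, hence trivial
  let u : Aut A := ⟨γ, γ', h1, h2⟩
  have hu : u = 1 := hut A u ⟨hγ2, hγl⟩
  have hγid : γ = 𝟙 A := congrArg Iso.hom hu
  rw [← hγ1, hγid, Category.id_comp]

/-- **Thm. 5.1 (iv), proof, first observation** (FrdI p. 99): in a Frobenioid of unit-trivial type
"a base-identity endomorphism of Frobenius type of `A` is uniquely determined by its Frobenius degree"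
(two such differ by an isomorphism, Def. 1.3 (ii), which is a base-identity linear automorphism, i.e.
a unit, hence trivial). [cite: MochizukiFrdI2008, Thm. 5.1 (iv) p.99] -/
theorem eq_of_isFrobeniusType_of_isBaseIdentity (hF : IsFrobenioid F) (hut : IsOfUnitTrivialType F)
    {A : C} {φ ψ : A ⟶ A} (hφ : IsFrobeniusType F φ) (hψ : IsFrobeniusType F ψ)
    (hφb : IsBaseIdentity F φ) (hψb : IsBaseIdentity F ψ) (h : degFr F φ = degFr F ψ) : φ = ψ := by
  obtain ⟨β, hβ⟩ := hF.ii_unique φ ψ hφ hψ h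
  have hφb' : Base F φ = 𝟙 _ := hφb
  have hψb' : Base F ψ = 𝟙 _ := hψb
  have hβb : IsBaseIdentity F β.hom := by
    show Base F β.hom = 𝟙 _
    have h1 := congrArg (Base F) hβ
    rw [base_comp, hφb', Category.id_comp, hψb'] at h1
    exact h1
  have hβ1' : β.hom = 𝟙 A := congrArg Iso.hom (hut A β ⟨hβb, isLinear_of_isIso F β.hom⟩)
  rw [hβ1', Category.comp_id] at hβ
  exact hβ

/-- **Thm. 5.1 (iv), proof** (FrdI p. 99): in a Frobenioid of isotropic and unit-trivial type,
base-identity endomorphisms of Frobenius type of the same degree at the two ends of a pull-back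
morphism `f : A → B` commute with `f` — the unique lift of `f ∘ φ_A`-type data along `f` (Def. 1.2
(ii)) is again a base-identity endomorphism of Frobenius type of the same degree (co-angularity is
automatic in isotropic type, Prop. 1.4 (i)), hence is `φ_A`.
[cite: MochizukiFrdI2008, Thm. 5.1 (iv) p.99] -/
theorem frobenius_comm_of_isPullbackMorphism (hF : IsFrobenioid F) (hiso : IsOfIsotropicType F)
    (hut : IsOfUnitTrivialType F) {A B : C} (f : A ⟶ B) (hf : IsPullbackMorphism F f)
    {φ : A ⟶ A} {ψ : B ⟶ B} (hφ : IsFrobeniusType F φ) (hφb : IsBaseIdentity F φ)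
    (hψ : IsFrobeniusType F ψ) (hψb : IsBaseIdentity F ψ) (hdeg : degFr F φ = degFr F ψ) :
    f ≫ ψ = φ ≫ f := by
  have hψb' : Base F ψ = 𝟙 _ := hψb
  -- lift `f ≫ ψ` along the pull-back morphism `f`
  obtain ⟨ξ, hξ⟩ := (hf A).2 ⟨(f ≫ ψ, 𝟙 _), by
    rw [base_comp, hψb', Category.comp_id, Category.id_comp]⟩
  have hξ1 : ξ ≫ f = f ≫ ψ := congrArg (fun p : PullbackHomData F f A => p.1.1) hξ
  have hξ2 : Base F ξ = 𝟙 _ := congrArg (fun p : PullbackHomData F f A => p.1.2) hξ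
  -- `f` is a linear isometry (Def. 1.3 (iv)(b))
  have hfi : Div F f = 1 := (hF.iv_b f hf).1.2
  have hfl : degFr F f = 1 := (hF.iv_b f hf).2
  have hψi : Div F ψ = 1 := hψ.1.2
  -- the lift has the degree of `ψ` …
  have hξdeg : degFr F ξ = degFr F ψ := by
    have hd := congrArg (degFr F) hξ1
    rw [degFr_comp, degFr_comp, hfl, mul_one, one_mul] at hd
    exact hd
  -- … and is an isometric base-isomorphism, co-angular since `C` is of isotropic type
  have hξi : IsIsometry F ξ := by
    show Div F ξ = 1
    have hd := congrArg (Div F) hξ1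
    simp only [div_comp, hξ2, hfi, hfl, hψi, map_one, one_mul, one_pow, mul_one, PNat.one_coe,
      pow_one] at hd
    exact hd
  have hξbi : IsBaseIso F ξ := by
    show IsIso (Base F ξ)
    rw [hξ2]
    infer_instance
  have hξFT : IsFrobeniusType F ξ :=
    ⟨⟨isCoAngular_of_isOfIsotropicType F hiso ξ, hξi⟩, hξbi⟩
  have hξφ : ξ = φ :=
    eq_of_isFrobeniusType_of_isBaseIdentity F hF hut hξFT hφ hξ2 hφb (hξdeg.trans hdeg.symm)
  rw [← hξ1, hξφ]

/-! ### Theorem 5.1 (iv), second clause: Frobenius-sections (unconditional) -/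

/-- **Theorem 5.1 (iv)**, second clause, PROVED: for a Frobenioid of isotropic and unit-trivial type
"any base-section of `C` admits an associated Frobenius-section `F`" — the Frobenius endomorphisms
`ζ_A(n)` of the (Frobenius-trivial) objects `A` of `P` are natural with respect to the (pull-back)
arrows of `P` (`frobenius_comm_of_isPullbackMorphism`), so `n ↦ (ζ_A(n))_A` is a homomorphism
`N_{≥1} → End(P ↪ C)` with the properties (a), (b) of Def. 2.7 (ii).
[cite: MochizukiFrdI2008, Thm. 5.1 (iv) p.97] -/
theorem thm51iv_frobeniusSection : Thm51iv_frobeniusSection F := by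
  intro hF hiso hut P hP
  have hFT : ∀ A : P.Cat, IsFrobeniusTrivial F A.1 := fun A => hP.isFrobeniusTrivial A.1 A.2
  choose ζ hζ using hFT
  -- naturality of the Frobenius endomorphisms along the arrows of `P`
  have nat : ∀ (n : ℕ+) {A B : P.Cat} (f : A ⟶ B),
      f.1 ≫ (show B.1 ⟶ B.1 from ζ B n) = (show A.1 ⟶ A.1 from ζ A n) ≫ f.1 := by
    intro n A B f
    exact frobenius_comm_of_isPullbackMorphism F hF hiso hut f.1 (hP.hom_pullback f.1 f.2)
      (hζ A n).2.2 (hζ A n).2.1 (hζ B n).2.2 (hζ B n).2.1 ((hζ A n).1.trans (hζ B n).1.symm)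
  let app : ℕ+ → End P.ι := fun n =>
    { app := fun A => (show A.1 ⟶ A.1 from ζ A n)
      naturality := fun A B f => nat n f }
  refine ⟨{ toFun := app, map_one' := ?_, map_mul' := ?_ }, ?_⟩
  · -- `ζ_A(1) = id`
    apply NatTrans.ext
    funext A
    show (show A.1 ⟶ A.1 from ζ A 1) = 𝟙 A.1
    rw [map_one]
    rfl
  · -- `ζ_A(m n) = ζ_A(m) ∘ ζ_A(n)`
    intro m n
    apply NatTrans.ext
    funext A
    show (show A.1 ⟶ A.1 from ζ A (m * n)) =
      (show A.1 ⟶ A.1 from ζ A n) ≫ (show A.1 ⟶ A.1 from ζ A m)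
    rw [map_mul]
    rfl
  · exact ⟨fun n A => (hζ A n).1, fun n A => (hζ A n).2.1, fun n A => (hζ A n).2.2⟩

/-- `Thm51iv_frobeniusSection` holds for all parameters — `_holds` alias of
`thm51iv_frobeniusSection` above (appended 2026-08-28, D-0026 bookkeeping: the proof term is the
existing theorem of this file; no statement, definition or attribute is edited; no new named
fact).
[cite: MochizukiFrdI2008, Thm. 5.1 (iv) p.97] -/
theorem Thm51iv_frobeniusSection_holds : Thm51iv_frobeniusSection F :=
  thm51iv_frobeniusSection F

/-! ### Theorem 5.1 (iv), first clause: base-sections, modulo Theorem 5.1 (iii) -/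

/-- **Thm. 5.1 (iv), proof** (FrdI p. 99): "by assertion (iii), it follows immediately that if
`A, B ∈ Ob(C^Fr-tr)`, then any morphism `Base(A) → Base(B)` [in `D`] lifts to a pull-back morphism"
`A → B` — modulo the two "In particular" clauses of Thm. 5.1 (iii): lift `θ` to a pull-back morphism
`X → B` by Def. 1.3 (i)(c); its domain is Frobenius-trivial; by (iii) it is isomorphic to `A` by an
isomorphism with prescribed base; compose. [cite: MochizukiFrdI2008, Thm. 5.1 (iv) p.99] -/
theorem exists_isPullbackMorphism_over_of_thm51iii (h₁ : Thm51iii_iso_of_baseIso F)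
    (h₂ : Thm51iii_frobeniusTrivial_isAutAmple F) (hF : IsFrobenioid F) (hiso : IsOfIsotropicType F)
    {A B : C} (hA : IsFrobeniusTrivial F A) (hB : IsFrobeniusTrivial F B)
    (θ : baseObj F A ⟶ baseObj F B) : ∃ f : A ⟶ B, IsPullbackMorphism F f ∧ Base F f = θ := by
  haveI := hF.i_c B
  -- Def. 1.3 (i)(c): `θ` is, up to isomorphism over `Base(B)`, the base of a pull-back morphism `g`
  obtain ⟨X, ⟨η⟩⟩ := Functor.EssSurj.mem_essImage (pullbackSliceToBase F B) (Over.mk θ)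
  have hg : IsPullbackMorphism F X.hom.1 := X.hom.2
  let e : baseObj F X.left.obj ≅ baseObj F A := (Over.forget _).mapIso η
  have hw : e.hom ≫ θ = Base F X.hom.1 := Over.w η.hom
  -- the domain of `g` is Frobenius-trivial, hence (iii) isomorphic to `A` over `e`
  have hX : IsFrobeniusTrivial F X.left.obj :=
    IsFrobeniusTrivial.of_isPullbackMorphism F hF hiso X.hom.1 hg hB
  obtain ⟨κ₀⟩ := h₁ hF hiso X.left.obj A hX hA ⟨e⟩
  obtain ⟨a, ha⟩ := h₂ hF hiso A hA ((baseFunctor F).mapIso κ₀.symm ≪≫ e)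
  have ha' : Base F a.hom = Base F κ₀.inv ≫ e.hom := congrArg Iso.hom ha
  let κ : X.left.obj ≅ A := κ₀ ≪≫ a
  have hκ : Base F κ.hom = e.hom := by
    show Base F (κ₀.hom ≫ a.hom) = e.hom
    rw [base_comp, ha', ← Category.assoc, ← base_comp, κ₀.hom_inv_id, base_id, Category.id_comp]
  have hκinv : Base F κ.inv ≫ e.hom = 𝟙 _ := by
    rw [← hκ, ← base_comp, κ.inv_hom_id, base_id]
  refine ⟨κ.inv ≫ X.hom.1, IsPullbackMorphism.comp F (isPullbackMorphism_of_isIso F κ.inv) hg, ?_⟩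
  rw [base_comp, ← hw, ← Category.assoc, hκinv, Category.id_comp]

/-- **Theorem 5.1 (iv)**, first clause, PROVED MODULO the "In particular" clauses of Thm. 5.1 (iii):
for a Frobenioid of isotropic and unit-trivial type, "any skeletal subcategory `P ⊆ (C^Fr-tr)^pl-bk`
determines a base-section of `C`" — `P → D` is faithful (pull-back morphisms are determined by their
base), full (lifting, previous lemma) and essentially surjective (Def. 1.3 (i)(a) and the skeleton
meets every Frobenius-trivial isomorphism class). [cite: MochizukiFrdI2008, Thm. 5.1 (iv) p.97] -/
theorem thm51iv_baseSection_of_thm51iii (h₁ : Thm51iii_iso_of_baseIso F)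
    (h₂ : Thm51iii_frobeniusTrivial_isAutAmple F) : Thm51iv_baseSection F := by
  intro hF hiso hut P hP
  have hpb : ∀ {A B : P.Cat} (f : A ⟶ B), IsPullbackMorphism F f.1 := fun f =>
    ((hP.hom_iff f.1).1 f.2).2.2
  haveI : (P.toBase F).Faithful := ⟨fun {A B} f g h =>
    Subtype.ext (IsPullbackMorphism.eq_of_base_eq F hF hut (hpb f) (hpb g) h)⟩
  haveI : (P.toBase F).Full := ⟨fun {A B} θ => by
    obtain ⟨f, hf, hfθ⟩ := exists_isPullbackMorphism_over_of_thm51iii F h₁ h₂ hF hiso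
      (hP.obj_isFrobeniusTrivial A.1 A.2) (hP.obj_isFrobeniusTrivial B.1 B.2) θ
    exact ⟨⟨f, (hP.hom_iff f).2 ⟨A.2, B.2, hf⟩⟩, hfθ⟩⟩
  haveI : (P.toBase F).EssSurj := ⟨fun d => by
    obtain ⟨A₀, hA₀, ⟨e₀⟩⟩ := hF.i_a d
    obtain ⟨B, hB, ⟨e₁⟩⟩ := hP.essSurj A₀ hA₀
    exact ⟨⟨B, hB⟩, ⟨(baseFunctor F).mapIso e₁.symm ≪≫ e₀⟩⟩⟩
  exact ⟨fun f hf => ((hP.hom_iff f).1 hf).2.2, hP.isSkeleton, hP.obj_isFrobeniusTrivial,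
    ⟨inferInstance, inferInstance, inferInstance⟩⟩

/-! ### Theorem 5.1 (iv), "Moreover": pre-model type, modulo Theorem 5.1 (iii) -/

/-- **Theorem 5.1 (iv)**, "Moreover, `C` is of model type" — its Def. 2.7 (iii) half, PROVED MODULO
the "In particular" clauses of Thm. 5.1 (iii): a Frobenioid of isotropic and unit-trivial type is of
pre-model type. A skeletal subcategory `P ⊆ (C^Fr-tr)^pl-bk` exists (representatives of the
isomorphism classes of Frobenius-trivial objects, with the pull-back morphisms between them); it is a
base-section by the first clause and carries a Frobenius-section by the second.
[cite: MochizukiFrdI2008, Thm. 5.1 (iv) p.97] -/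
theorem thm51iv_preModel_of_thm51iii (h₁ : Thm51iii_iso_of_baseIso F)
    (h₂ : Thm51iii_frobeniusTrivial_isAutAmple F) : Thm51iv_preModel F := by
  intro hF hiso hut
  -- representatives of the isomorphism classes of Frobenius-trivial objects
  let S : Setoid {A : C // IsFrobeniusTrivial F A} :=
    ⟨fun A B => Nonempty (A.1 ≅ B.1),
      ⟨fun A => ⟨Iso.refl A.1⟩, fun ⟨e⟩ => ⟨e.symm⟩, fun ⟨e₁⟩ ⟨e₂⟩ => ⟨e₁ ≪≫ e₂⟩⟩⟩
  let rep : {A : C // IsFrobeniusTrivial F A} → C := fun A => (Quotient.mk S A).out.1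
  have rep_ft : ∀ A, IsFrobeniusTrivial F (rep A) := fun A => (Quotient.mk S A).out.2
  have rep_iso : ∀ A, Nonempty (rep A ≅ A.1) := fun A => Quotient.mk_out (s := S) A
  have rep_eq : ∀ A B, Nonempty (A.1 ≅ B.1) → rep A = rep B := fun A B h => by
    show (Quotient.mk S A).out.1 = (Quotient.mk S B).out.1
    rw [Quotient.sound (s := S) h]
  -- the skeleton `P ⊆ (C^Fr-tr)^pl-bk` on the representatives
  let Pobj : C → Prop := fun A => ∃ h : IsFrobeniusTrivial F A, rep ⟨A, h⟩ = A
  let P : Presection C :=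
    { obj := Pobj
      hom := fun {A B} f => Pobj A ∧ Pobj B ∧ IsPullbackMorphism F f
      obj_of_hom := fun f hf => ⟨hf.1, hf.2.1⟩
      hom_id := fun {A} hA => ⟨hA, hA, isPullbackMorphism_of_isIso F (𝟙 A)⟩
      hom_comp := fun f g hf hg => ⟨hf.1, hg.2.1, IsPullbackMorphism.comp F hf.2.2 hg.2.2⟩ }
  have hP : IsSkeletalSubcatFrTrPlbk F P :=
    { obj_isFrobeniusTrivial := fun A hA => hA.1
      hom_iff := fun f => Iff.rfl
      isSkeleton := fun A B hAB => by
        obtain ⟨e⟩ := hAB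
        obtain ⟨hA, hA'⟩ := A.2
        obtain ⟨hB, hB'⟩ := B.2
        apply Subtype.ext
        have e' : A.1 ≅ B.1 := P.ι.mapIso e
        calc A.1 = rep ⟨A.1, hA⟩ := hA'.symm
          _ = rep ⟨B.1, hB⟩ := rep_eq _ _ ⟨e'⟩
          _ = B.1 := hB'
      essSurj := fun A hA => by
        obtain ⟨e⟩ := rep_iso ⟨A, hA⟩
        exact ⟨rep ⟨A, hA⟩, ⟨rep_ft ⟨A, hA⟩, rep_eq _ _ ⟨e⟩⟩, ⟨e.symm⟩⟩ }
  have hbs : IsBaseSection F P := thm51iv_baseSection_of_thm51iii F h₁ h₂ hF hiso hut P hP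
  obtain ⟨Fr, hFr⟩ := thm51iv_frobeniusSection F hF hiso hut P hbs
  exact ⟨P, Fr, ⟨hbs, hFr⟩⟩

end PreFrobenioid

end Literature.AlgebraicGeometry.Frobenioids
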